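import Summits.AtomisticToContinuum.HydrodynamicLimit.Theorems.InformationPercolationEngineChaosClosesEulerLocalEquilibriumFromDissipationC
import Summits.AtomisticToContinuum.HydrodynamicLimit.Theorems.InformationPercolationEngineChaosClosesEulerCollisionMomentUI
import Summits.AtomisticToContinuum.HydrodynamicLimit.Theorems.InformationPercolationEngineChaosClosesEulerPressureValueE
import HarnessLib

/-!
# Pointwise local equilibrium from the empirical H-theorem (crux `ChaosClosesEuler`, stmt-AtomisticToContinuum-15141,
# line `empirical-h-theorem`, stub `stub_localEquilibriumFromDissipation`) — helper D: the collision side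

WHAT. Pathwise bookkeeping of the normalised ordered-contact-pair collision sums of ONE good orbit,
`csum Φ τ F z = (ε/(N+1)) Σ_{collisions s ≤ τ} Σ_{contact pairs (i,j)} F s i j` (DEFINITIONALLY the `Kent`, `Kr`, `Q4` of
the statement and the `Kc` of `CollisionMomentUI`): finite-sum form, linearity, termwise comparison; the EXCHANGE of
the window integral `∫_{t₀} ∫_{x₀}` with the collision sum for tent × (continuous weight) terms; the unit mass of the
cone–cone kernel `∫_{x₀}∫ₓ b_r(x,x₀) b_r(y,x) = 1`; the cone-localised entropic mark integral `markI` and its LOG-GROWTH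
bound through the density weight (the weight vanishes where `ρ_r` is large, so the constant is `r`-free, helper A);
and `kent_sub_kr_le`: the window `L¹(dt₀ dx₀)`-distance between the entropic collision functional and its
pair-energy-cut version is at most `C_h (2A + 4) · K_N[(1 + |vᵢ|² + |vⱼ|²) 1{|vᵢ|² + |vⱼ|² > L}]`, the functional of
`CollisionMomentUI` (elastic reflection conserves the pair energy).
References: M. Pulvirenti, S. Simonella, arXiv:1504.03215 §3; C. Cercignani, R. Illner, M. Pulvirenti (1994) App. 4.A.
-/

noncomputable section

namespace Summit.AtomisticToContinuum.HydrodynamicLimit.Theorems.ChaosClosesEulerLocalEquilibriumFromDissipation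

open scoped BigOperators Topology Classical MeasureTheory ENNReal InnerProductSpace
open Filter Set MeasureTheory Function
open Literature.MathematicalPhysics.KineticTheory
open Literature.Analysis.FluidPDE
open Summit.AtomisticToContinuum.HydrodynamicLimit.Theorems.LocalSecondLawNegative
open Summit.AtomisticToContinuum.HydrodynamicLimit.Theorems.LocalSecondLawLedger
open Summit.AtomisticToContinuum.HydrodynamicLimit.Theorems.ChaosClosesEulerPressureValue
  (finite_collisionTimes_Icc integrable_tent_sub setIntegral_tent_le_one setIntegral_tent_nonneg continuous_tent_sub)
open Summit.AtomisticToContinuum.HydrodynamicLimit.Theorems.ChaosClosesEulerWindowedInvariance (tent_nonneg_le)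

variable {σ : ℝ} {N : ℕ}

/-! ## §1 Normalised ordered-contact-pair collision sums -/

/-- **The normalised collision sum** `(ε/(N+1)) Σ_{collisions s ∈ [0,τ]} Σ_{ordered contact pairs (i,j)} F s i j` of a
mark `F` along the orbit of `z` (the `Kent`, `Kr`, `Q4` of the statement, the `Kc` of `CollisionMomentUI`). [folklore] -/
def csum (Φ : HardSphereFlow (Torus.geometry (Fin 3)) (hsDiameter σ N) (N + 1)) (τ : ℝ)
    (F : ℝ → Fin (N + 1) → Fin (N + 1) → ℝ) (z : Phase N) : ℝ :=
  hsDiameter σ N / (N + 1 : ℝ) *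
    ∑ᶠ (s : ℝ) (_ : s ∈ collisionTimes (Torus.geometry (Fin 3)) (hsDiameter σ N) (fun s => Φ.flow s z) ∩ Set.Icc 0 τ),
      ∑ i : Fin (N + 1), ∑ j : Fin (N + 1),
        (if i ≠ j ∧ ‖(Torus.geometry (Fin 3)).sepVec (Φ.flow s z i).1 (Φ.flow s z j).1‖ = hsDiameter σ N then F s i j else 0)

/-- **The pre-collisional pair** `(vᵢ⁻, vⱼ⁻) = reflectVel (xᵢ − xⱼ) (vᵢ, vⱼ)` of the right-continuous orbit (the `pv`
of the statement). [folklore] -/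
def pvel (Φ : HardSphereFlow (Torus.geometry (Fin 3)) (hsDiameter σ N) (N + 1)) (z : Phase N) (s : ℝ)
    (i j : Fin (N + 1)) : V3 × V3 :=
  reflectVel ((Torus.geometry (Fin 3)).sepVec (Φ.flow s z i).1 (Φ.flow s z j).1) ((Φ.flow s z i).2, (Φ.flow s z j).2)

section CSum

variable (Φ : HardSphereFlow (Torus.geometry (Fin 3)) (hsDiameter σ N) (N + 1)) {z : Phase N}

/-- The collision sum as an honest finite sum along a good orbit. [folklore] -/
theorem csum_eq_sum (hz : z ∈ Φ.good) (τ : ℝ) (F : ℝ → Fin (N + 1) → Fin (N + 1) → ℝ) :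
    csum Φ τ F z = hsDiameter σ N / (N + 1 : ℝ) * ∑ s ∈ (finite_collisionTimes_Icc Φ hz τ).toFinset,
      ∑ i : Fin (N + 1), ∑ j : Fin (N + 1),
        (if i ≠ j ∧ ‖(Torus.geometry (Fin 3)).sepVec (Φ.flow s z i).1 (Φ.flow s z j).1‖ = hsDiameter σ N then F s i j
          else 0) := by
  unfold csum; rw [finsum_mem_eq_finite_toFinset_sum _ (finite_collisionTimes_Icc Φ hz τ)]

/-- Additivity: `K[F + G] = K[F] + K[G]`. [folklore] -/
theorem csum_add (hz : z ∈ Φ.good) (τ : ℝ) (F G : ℝ → Fin (N + 1) → Fin (N + 1) → ℝ) :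
    csum Φ τ (fun s i j => F s i j + G s i j) z = csum Φ τ F z + csum Φ τ G z := by
  -- adapted from `ChaosClosesEulerPressureValue.collisionSum_add`
  simp only [csum_eq_sum Φ hz]
  rw [← mul_add, ← Finset.sum_add_distrib]
  congr 1
  refine Finset.sum_congr rfl fun s _ => ?_
  rw [← Finset.sum_add_distrib]
  refine Finset.sum_congr rfl fun i _ => ?_
  rw [← Finset.sum_add_distrib]
  refine Finset.sum_congr rfl fun j _ => ?_
  split_ifs <;> simp

/-- Linearity: `K[F] − K[G] = K[F − G]`. [folklore] -/
theorem csum_sub (hz : z ∈ Φ.good) (τ : ℝ) (F G : ℝ → Fin (N + 1) → Fin (N + 1) → ℝ) :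
    csum Φ τ F z - csum Φ τ G z = csum Φ τ (fun s i j => F s i j - G s i j) z := by
  have h := csum_add Φ hz τ (fun s i j => F s i j - G s i j) G
  simp only [sub_add_cancel] at h; linarith

/-- Homogeneity: `K[c F] = c K[F]`. [folklore] -/
theorem csum_const_mul (hz : z ∈ Φ.good) (τ c : ℝ) (F : ℝ → Fin (N + 1) → Fin (N + 1) → ℝ) :
    csum Φ τ (fun s i j => c * F s i j) z = c * csum Φ τ F z := by
  simp only [csum_eq_sum Φ hz]
  rw [mul_left_comm c]
  congr 1
  rw [Finset.mul_sum]
  refine Finset.sum_congr rfl fun s _ => ?_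
  rw [Finset.mul_sum]
  refine Finset.sum_congr rfl fun i _ => ?_
  rw [Finset.mul_sum]
  refine Finset.sum_congr rfl fun j _ => ?_
  split_ifs <;> simp

/-- **Termwise comparison**: `|F| ≤ G` on `[0, τ]` gives `|K[F]| ≤ K[G]` (`0 < σ`). [folklore] -/
theorem abs_csum_le (hz : z ∈ Φ.good) (hσ : 0 < σ) {τ : ℝ} {F G : ℝ → Fin (N + 1) → Fin (N + 1) → ℝ}
    (h : ∀ s ∈ Set.Icc (0 : ℝ) τ, ∀ i j, |F s i j| ≤ G s i j) : |csum Φ τ F z| ≤ csum Φ τ G z := by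
  have hc0 : 0 ≤ hsDiameter σ N / (N + 1 : ℝ) := div_nonneg (hsDiameter_pos hσ N).le (by positivity)
  simp only [csum_eq_sum Φ hz]
  rw [abs_mul, abs_of_nonneg hc0]
  refine mul_le_mul_of_nonneg_left ((Finset.abs_sum_le_sum_abs _ _).trans (Finset.sum_le_sum fun s hs => ?_)) hc0
  have hsI : s ∈ Set.Icc (0 : ℝ) τ := ((Set.Finite.mem_toFinset _).1 hs).2
  refine (Finset.abs_sum_le_sum_abs _ _).trans (Finset.sum_le_sum fun i _ => ?_)
  refine (Finset.abs_sum_le_sum_abs _ _).trans (Finset.sum_le_sum fun j _ => ?_)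
  split_ifs
  · exact h s hsI i j
  · simp

/-- Monotonicity: `F ≤ G` on `[0, τ]` gives `K[F] ≤ K[G]` (`0 < σ`). [folklore] -/
theorem csum_mono (hz : z ∈ Φ.good) (hσ : 0 < σ) {τ : ℝ} {F G : ℝ → Fin (N + 1) → Fin (N + 1) → ℝ}
    (h : ∀ s ∈ Set.Icc (0 : ℝ) τ, ∀ i j, F s i j ≤ G s i j) : csum Φ τ F z ≤ csum Φ τ G z := by
  have hc0 : 0 ≤ hsDiameter σ N / (N + 1 : ℝ) := div_nonneg (hsDiameter_pos hσ N).le (by positivity)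
  simp only [csum_eq_sum Φ hz]
  refine mul_le_mul_of_nonneg_left (Finset.sum_le_sum fun s hs => ?_) hc0
  have hsI : s ∈ Set.Icc (0 : ℝ) τ := ((Set.Finite.mem_toFinset _).1 hs).2
  refine Finset.sum_le_sum fun i _ => Finset.sum_le_sum fun j _ => ?_
  split_ifs
  · exact h s hsI i j
  · exact le_rfl

/-- **Abstract exchange lemma**: the `(t₀, x₀)`-integral over `[lo, hi] × 𝕋³` of a finite sum of tent × (continuous
weight) × constant terms is the finite sum of (tent mass) × (weight mass) × constant. [folklore] -/
theorem integral_integral_sum_window' (Fs : Finset ℝ) (P : ℝ → Fin (N + 1) → Fin (N + 1) → Prop)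
    [∀ s i j, Decidable (P s i j)] {W : ℝ → Fin (N + 1) → Fin (N + 1) → T3 → ℝ} (hW : ∀ s i j, Continuous (W s i j))
    (X : ℝ → Fin (N + 1) → Fin (N + 1) → ℝ) (C lo hi r : ℝ) :
    ∫ t₀ in Set.Icc lo hi, ∫ x₀, C * ∑ s ∈ Fs, ∑ i, ∑ j,
        (if P s i j then r⁻¹ * max (1 - |s - t₀| / r) 0 * W s i j x₀ * X s i j else 0) =
      C * ∑ s ∈ Fs, ∑ i, ∑ j, (if P s i j then
        (∫ t₀ in Set.Icc lo hi, r⁻¹ * max (1 - |s - t₀| / r) 0) * (∫ x₀, W s i j x₀) * X s i j else 0) := by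
  -- adapted from `ChaosClosesEulerPressureValue.integral_integral_mul_sum_window`
  have hinner : ∀ t₀, ∫ x₀, C * ∑ s ∈ Fs, ∑ i, ∑ j,
      (if P s i j then r⁻¹ * max (1 - |s - t₀| / r) 0 * W s i j x₀ * X s i j else 0) =
      C * ∑ s ∈ Fs, ∑ i, ∑ j,
        (if P s i j then r⁻¹ * max (1 - |s - t₀| / r) 0 * (∫ x₀, W s i j x₀) * X s i j else 0) := by
    intro t₀
    have hterm : ∀ s i j, Integrable (fun x₀ : T3 =>
        if P s i j then r⁻¹ * max (1 - |s - t₀| / r) 0 * W s i j x₀ * X s i j else 0) volume := by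
      intro s i j
      split_ifs
      · exact integrable_of_continuous_T3 ((continuous_const.mul (hW s i j)).mul continuous_const)
      · exact integrable_const 0
    rw [integral_const_mul, integral_finsetSum _ fun s _ =>
      integrable_finsetSum _ fun i _ => integrable_finsetSum _ fun j _ => hterm s i j]
    congr 1
    refine Finset.sum_congr rfl fun s _ => ?_
    rw [integral_finsetSum _ fun i _ => integrable_finsetSum _ fun j _ => hterm s i j]
    refine Finset.sum_congr rfl fun i _ => ?_
    rw [integral_finsetSum _ fun j _ => hterm s i j]
    refine Finset.sum_congr rfl fun j _ => ?_
    split_ifs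
    · rw [integral_mul_const, integral_const_mul]
    · exact integral_zero _ _
  simp_rw [hinner]
  have hterm : ∀ s i j, IntegrableOn (fun t₀ : ℝ =>
      if P s i j then r⁻¹ * max (1 - |s - t₀| / r) 0 * (∫ x₀, W s i j x₀) * X s i j else 0) (Set.Icc lo hi) volume := by
    intro s i j
    split_ifs
    · exact (((continuous_tent_sub r s).mul continuous_const).mul continuous_const).continuousOn.integrableOn_compact
        isCompact_Icc
    · exact integrableOn_const (by rw [Real.volume_Icc]; exact ENNReal.ofReal_ne_top)
  rw [integral_const_mul, integral_finsetSum _ fun s _ =>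
    integrable_finsetSum _ fun i _ => integrable_finsetSum _ fun j _ => hterm s i j]
  congr 1
  refine Finset.sum_congr rfl fun s _ => ?_
  rw [integral_finsetSum _ fun i _ => integrable_finsetSum _ fun j _ => hterm s i j]
  refine Finset.sum_congr rfl fun i _ => ?_
  rw [integral_finsetSum _ fun j _ => hterm s i j]
  refine Finset.sum_congr rfl fun j _ => ?_
  split_ifs
  · rw [integral_mul_const, integral_mul_const]
  · exact integral_zero _ _

/-- **Exchange lemma**: the `(t₀, x₀)`-integral over `[lo, hi] × 𝕋³` of the collision sum of tent × (continuous
weight) × constant terms is the collision sum of (tent mass) × (weight mass) × constant. [folklore] -/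
theorem integral_integral_csum_window (hz : z ∈ Φ.good) {W : ℝ → Fin (N + 1) → Fin (N + 1) → T3 → ℝ}
    (hW : ∀ s i j, Continuous (W s i j)) (X : ℝ → Fin (N + 1) → Fin (N + 1) → ℝ) (lo hi r τ : ℝ) :
    ∫ t₀ in Set.Icc lo hi, ∫ x₀, csum Φ τ (fun s i j => r⁻¹ * max (1 - |s - t₀| / r) 0 * W s i j x₀ * X s i j) z =
      csum Φ τ (fun s i j => (∫ t₀ in Set.Icc lo hi, r⁻¹ * max (1 - |s - t₀| / r) 0) * (∫ x₀, W s i j x₀) * X s i j) z := by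
  simp only [csum_eq_sum Φ hz]
  exact integral_integral_sum_window' _ _ hW X _ lo hi r

/-- **Joint continuity of the windowed collision sum**: for weights `W s i j` continuous in `x₀`, the collision sum of
tent × weight × constant terms is jointly continuous in the window centre `(t₀, x₀)`. [folklore] -/
theorem continuous_csum_window (hz : z ∈ Φ.good) {W : ℝ → Fin (N + 1) → Fin (N + 1) → T3 → ℝ}
    (hW : ∀ s i j, Continuous (W s i j)) (X : ℝ → Fin (N + 1) → Fin (N + 1) → ℝ) (r τ : ℝ) :
    Continuous fun p : ℝ × T3 => csum Φ τ (fun s i j => r⁻¹ * max (1 - |s - p.1| / r) 0 * W s i j p.2 * X s i j) z := by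
  simp only [csum_eq_sum Φ hz]
  refine continuous_const.mul (continuous_finsetSum _ fun s _ => continuous_finsetSum _ fun i _ =>
    continuous_finsetSum _ fun j _ => ?_)
  split_ifs
  · exact ((((continuous_tent_sub r s).comp continuous_fst).mul ((hW s i j).comp continuous_snd)).mul continuous_const)
  · exact continuous_const

end CSum

/-- `x₀ ↦ ∫ₓ b_r(x, x₀) b_r(y, x) dx` is continuous. [folklore] -/
theorem continuous_coneCone (r : ℝ) (y : T3) : Continuous fun x₀ : T3 => ∫ x, cone r x x₀ * cone r y x := by
  have hf : Continuous (Function.uncurry fun (x₀ : T3) (x : T3) => cone r x x₀ * cone r y x) :=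
    ((continuous_cone_uncurry' r).comp (continuous_snd.prodMk continuous_fst)).mul ((continuous_cone r y).comp continuous_snd)
  have h := continuous_parametric_integral_of_continuous (μ := (volume : Measure T3)) hf isCompact_univ
  simp only [Measure.restrict_univ] at h
  exact h

/-- `0 ≤ ∫ₓ b_r(x, x₀) b_r(y, x) dx` (`0 < r`). [folklore] -/
theorem coneCone_nonneg {r : ℝ} (hr : 0 < r) (y x₀ : T3) : 0 ≤ ∫ x, cone r x x₀ * cone r y x :=
  integral_nonneg fun _ => mul_nonneg (cone_nonneg hr _ _) (cone_nonneg hr _ _)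

/-- **Unit mass of the cone–cone kernel**: `∫_{x₀} ∫ₓ b_r(x, x₀) b_r(y, x) dx dx₀ = 1` (`0 < r < 1/2`; Tonelli). [folklore] -/
theorem integral_integral_coneCone {r : ℝ} (hr : 0 < r) (hr2 : r < 1 / 2) (y : T3) :
    ∫ x₀, ∫ x, cone r x x₀ * cone r y x = 1 := by
  have hc : Continuous fun p : T3 × T3 => cone r p.2 p.1 * cone r y p.2 :=
    ((continuous_cone_uncurry' r).comp (continuous_snd.prodMk continuous_fst)).mul ((continuous_cone r y).comp continuous_snd)
  have hint : Integrable (Function.uncurry fun (x₀ : T3) (x : T3) => cone r x x₀ * cone r y x)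
      ((volume : Measure T3).prod volume) :=
    Integrable.of_bound hc.aestronglyMeasurable ((3 / (Real.pi * r ^ 3)) ^ 2) (ae_of_all _ fun p => by
      rw [Real.norm_eq_abs]
      show |cone r p.2 p.1 * cone r y p.2| ≤ (3 / (Real.pi * r ^ 3)) ^ 2
      rw [abs_mul, sq]
      exact mul_le_mul (L.abs_cone_le hr _ _) (L.abs_cone_le hr _ _) (abs_nonneg _) (by positivity))
  rw [integral_integral_swap hint]
  have h1 : ∀ x : T3, ∫ x₀, cone r x x₀ * cone r y x = cone r y x := fun x => by
    have h2 : ∫ x₀, cone r x x₀ = 1 := integral_cone_eq_one hr hr2 x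
    rw [integral_mul_const, h2, one_mul]
  simp_rw [h1]
  have h3 : ∫ x, cone r y x = 1 := integral_cone_eq_one hr hr2 y
  exact h3

/-- **The cone-localised entropic mark integral** `∫ₓ b_r(x, x₀) h(ρ_r(x)) b_r(y, x) [Λ̃_x(v′) − Λ̃_x(v)] dx` of the
statement (particle at `y`, window centre `x₀`). [folklore] -/
def markI (r δ K : ℝ) (h : ℝ → ℝ) (w : Phase N) (y : T3) (v' v : V3) (x₀ : T3) : ℝ :=
  ∫ x, cone r x x₀ * h (rhoC r w x) * cone r y x * (LamC r δ K w x v' - LamC r δ K w x v)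

/-- **LOG-GROWTH BOUND OF THE LOCALISED MARK**: if `|h| ≤ C_h` and `h = 0` on `[ρ̄, ∞)` (`ρ̄ ≥ 0`), then
`|markI| ≤ C_h (2A(K, δ, ρ̄) + 2(‖v′‖² + ‖v‖²)) ∫ₓ b_r(x, x₀) b_r(y, x) dx` (an `r`-free constant: where the weight does
not vanish, `ρ_r(x) < ρ̄` and helper A applies). [folklore] -/
theorem abs_markI_le {r : ℝ} (hr : 0 < r) {δ : ℝ} (hδ : 0 < δ) (K : ℝ) {h : ℝ → ℝ} {Ch ρb : ℝ}
    (hCh : ∀ a, |h a| ≤ Ch) (hh0 : ∀ a, ρb ≤ a → h a = 0) (hρb : 0 ≤ ρb) (w : Phase N) (y : T3) (v' v : V3) (x₀ : T3) :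
    |markI r δ K h w y v' v x₀| ≤ Ch * (2 * ALam K δ ρb + 2 * (‖v'‖ ^ 2 + ‖v‖ ^ 2)) * ∫ x, cone r x x₀ * cone r y x := by
  have hCh0 : 0 ≤ Ch := (abs_nonneg _).trans (hCh 0)
  have hA := ALam_nonneg K δ hρb
  set M := Ch * (2 * ALam K δ ρb + 2 * (‖v'‖ ^ 2 + ‖v‖ ^ 2)) with hM
  have hM0 : 0 ≤ M := by positivity
  have hg : Integrable (fun x : T3 => cone r x x₀ * cone r y x * M) volume :=
    (integrable_of_continuous_T3 (((continuous_cone_uncurry' r).comp (continuous_id.prodMk continuous_const)).mul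
      (continuous_cone r y))).mul_const M
  have hpt : ∀ x : T3, ‖cone r x x₀ * h (rhoC r w x) * cone r y x * (LamC r δ K w x v' - LamC r δ K w x v)‖ ≤
      cone r x x₀ * cone r y x * M := by
    intro x
    have hc1 := cone_nonneg hr x x₀; have hc2 := cone_nonneg hr y x
    rw [Real.norm_eq_abs, abs_mul, abs_mul, abs_mul, abs_of_nonneg hc1, abs_of_nonneg hc2]
    by_cases hx : h (rhoC r w x) = 0
    · rw [hx, abs_zero, mul_zero, zero_mul, zero_mul]; positivity
    · have hρ : rhoC r w x ≤ ρb := by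
        by_contra hlt; exact hx (hh0 _ (not_le.1 hlt).le)
      have h1 := abs_LamC_le hr hδ K w x hρ v'; have h2 := abs_LamC_le hr hδ K w x hρ v
      have hdiff : |LamC r δ K w x v' - LamC r δ K w x v| ≤ 2 * ALam K δ ρb + 2 * (‖v'‖ ^ 2 + ‖v‖ ^ 2) :=
        (abs_sub _ _).trans (by linarith)
      calc cone r x x₀ * |h (rhoC r w x)| * cone r y x * |LamC r δ K w x v' - LamC r δ K w x v|
          ≤ cone r x x₀ * Ch * cone r y x * (2 * ALam K δ ρb + 2 * (‖v'‖ ^ 2 + ‖v‖ ^ 2)) :=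
            mul_le_mul (mul_le_mul_of_nonneg_right (mul_le_mul_of_nonneg_left (hCh _) hc1) hc2) hdiff (abs_nonneg _)
              (by positivity)
        _ = cone r x x₀ * cone r y x * M := by rw [hM]; ring
  have h := norm_integral_le_of_norm_le hg (ae_of_all _ hpt)
  rw [Real.norm_eq_abs, integral_mul_const, mul_comm] at h
  exact h

/-- The pair-energy cut seen on the pre-collisional pair: `1 − cut(vᵢ⁻, vⱼ⁻) = 1{L < |vᵢ|² + |vⱼ|²}` (elastic reflection
conserves the pair energy). [folklore] -/
theorem one_sub_cutL_reflectVel (L : ℝ) (n : V3) (p : V3 × V3) :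
    1 - cutL L (reflectVel n p).1 (reflectVel n p).2 = if L < ‖p.1‖ ^ 2 + ‖p.2‖ ^ 2 then 1 else 0 := by
  unfold cutL
  rw [norm_sq_reflectVel_fst_add_norm_sq_reflectVel_snd]
  by_cases h1 : ‖p.1‖ ^ 2 + ‖p.2‖ ^ 2 ≤ L
  · rw [if_pos h1, if_neg (not_lt.2 h1)]; norm_num
  · rw [if_neg h1, if_pos (not_le.1 h1)]; norm_num

section KentKr

variable (Φ : HardSphereFlow (Torus.geometry (Fin 3)) (hsDiameter σ N) (N + 1)) {z : Phase N}

/-- **THE PAIR-ENERGY CUT COSTS THE QUADRATIC COLLISION MARK.** Along a good orbit, for a density weight `h` with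
`|h| ≤ C_h`, `h = 0` on `[ρ̄, ∞)`, the window `L¹(dt₀ dx₀)`-distance over `[0, τ] × 𝕋³` between the tent × cone windowed
entropic collision functional (`Kent`) and its pair-energy-cut version (`Kr`) is at most
`C_h (2A + 4) · K_N[(1 + |vᵢ|² + |vⱼ|²) 1{L < |vᵢ|² + |vⱼ|²}]` (`0 < r < 1/2`, `0 < σ`). [folklore] -/
theorem kent_sub_kr_le (hz : z ∈ Φ.good) (hσ : 0 < σ) {r : ℝ} (hr : 0 < r) (hr2 : r < 1 / 2) {δ : ℝ} (hδ : 0 < δ)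
    (K L τ : ℝ) {h : ℝ → ℝ} {Ch ρb : ℝ} (hCh : ∀ a, |h a| ≤ Ch) (hh0 : ∀ a, ρb ≤ a → h a = 0) (hρb : 0 ≤ ρb) :
    ∫ t₀ in Set.Icc 0 τ, ∫ x₀,
      |csum Φ τ (fun s i j => r⁻¹ * max (1 - |s - t₀| / r) 0 *
          markI r δ K h (Φ.flow s z) (Φ.flow s z i).1 (pvel Φ z s i j).1 (Φ.flow s z i).2 x₀) z -
        csum Φ τ (fun s i j => r⁻¹ * max (1 - |s - t₀| / r) 0 * cutL L (pvel Φ z s i j).1 (pvel Φ z s i j).2 *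
          markI r δ K h (Φ.flow s z) (Φ.flow s z i).1 (pvel Φ z s i j).1 (Φ.flow s z i).2 x₀) z| ≤
      Ch * (2 * ALam K δ ρb + 4) * csum Φ τ (fun s i j =>
        if L < ‖(Φ.flow s z i).2‖ ^ 2 + ‖(Φ.flow s z j).2‖ ^ 2 then 1 + ‖(Φ.flow s z i).2‖ ^ 2 + ‖(Φ.flow s z j).2‖ ^ 2
        else 0) z := by
  have hCh0 : 0 ≤ Ch := (abs_nonneg _).trans (hCh 0)
  have hA := ALam_nonneg K δ hρb
  -- the dominating mark `Xs` and the dominating window field `G`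
  set Xs : ℝ → Fin (N + 1) → Fin (N + 1) → ℝ := fun s i j => Ch * (2 * ALam K δ ρb + 4) *
    (if L < ‖(Φ.flow s z i).2‖ ^ 2 + ‖(Φ.flow s z j).2‖ ^ 2 then 1 + ‖(Φ.flow s z i).2‖ ^ 2 + ‖(Φ.flow s z j).2‖ ^ 2
      else 0) with hXs
  have hXs0 : ∀ s i j, 0 ≤ Xs s i j := fun s i j => by
    rw [hXs]; dsimp only; split_ifs <;> positivity
  set W : ℝ → Fin (N + 1) → Fin (N + 1) → T3 → ℝ := fun s i _ x₀ => ∫ x, cone r x x₀ * cone r (Φ.flow s z i).1 x with hW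
  have hWc : ∀ s i j, Continuous (W s i j) := fun s i j => continuous_coneCone r _
  set G : ℝ → T3 → ℝ := fun t₀ x₀ => csum Φ τ (fun s i j => r⁻¹ * max (1 - |s - t₀| / r) 0 * W s i j x₀ * Xs s i j) z
    with hG
  -- Step 1: pointwise domination
  have hdom : ∀ t₀ x₀, |csum Φ τ (fun s i j => r⁻¹ * max (1 - |s - t₀| / r) 0 *
          markI r δ K h (Φ.flow s z) (Φ.flow s z i).1 (pvel Φ z s i j).1 (Φ.flow s z i).2 x₀) z -
        csum Φ τ (fun s i j => r⁻¹ * max (1 - |s - t₀| / r) 0 * cutL L (pvel Φ z s i j).1 (pvel Φ z s i j).2 *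
          markI r δ K h (Φ.flow s z) (Φ.flow s z i).1 (pvel Φ z s i j).1 (Φ.flow s z i).2 x₀) z| ≤ G t₀ x₀ := by
    intro t₀ x₀
    rw [csum_sub Φ hz, hG]
    refine abs_csum_le Φ hz hσ fun s _ i j => ?_
    have ht := tent_nonneg_le hr (s - t₀)
    set E := ‖(Φ.flow s z i).2‖ ^ 2 + ‖(Φ.flow s z j).2‖ ^ 2 with hE
    have hind : 1 - cutL L (pvel Φ z s i j).1 (pvel Φ z s i j).2 = if L < E then 1 else 0 :=
      one_sub_cutL_reflectVel L _ _
    have hm := abs_markI_le hr hδ K hCh hh0 hρb (Φ.flow s z) (Φ.flow s z i).1 (pvel Φ z s i j).1 (Φ.flow s z i).2 x₀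
    have hcc := coneCone_nonneg hr (Φ.flow s z i).1 x₀
    have hpv : ‖(pvel Φ z s i j).1‖ ^ 2 ≤ E := by
      have := norm_sq_reflectVel_fst_add_norm_sq_reflectVel_snd
        ((Torus.geometry (Fin 3)).sepVec (Φ.flow s z i).1 (Φ.flow s z j).1) ((Φ.flow s z i).2, (Φ.flow s z j).2)
      rw [hE]; unfold pvel; nlinarith [sq_nonneg ‖(pvel Φ z s i j).2‖]
    have hvi : ‖(Φ.flow s z i).2‖ ^ 2 ≤ E := by rw [hE]; nlinarith [sq_nonneg ‖(Φ.flow s z j).2‖]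
    have hfac : r⁻¹ * max (1 - |s - t₀| / r) 0 * markI r δ K h (Φ.flow s z) (Φ.flow s z i).1 (pvel Φ z s i j).1
          (Φ.flow s z i).2 x₀ -
        r⁻¹ * max (1 - |s - t₀| / r) 0 * cutL L (pvel Φ z s i j).1 (pvel Φ z s i j).2 *
          markI r δ K h (Φ.flow s z) (Φ.flow s z i).1 (pvel Φ z s i j).1 (Φ.flow s z i).2 x₀ =
        r⁻¹ * max (1 - |s - t₀| / r) 0 * (if L < E then 1 else 0) *
          markI r δ K h (Φ.flow s z) (Φ.flow s z i).1 (pvel Φ z s i j).1 (Φ.flow s z i).2 x₀ := by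
      rw [← hind]; ring
    rw [hfac]
    by_cases hLE : L < E
    · rw [if_pos hLE, mul_one, abs_mul, abs_of_nonneg ht.1]
      have hX : Xs s i j = Ch * (2 * ALam K δ ρb + 4) * (1 + E) := by
        have hLE' : L < ‖(Φ.flow s z i).2‖ ^ 2 + ‖(Φ.flow s z j).2‖ ^ 2 := by rwa [hE] at hLE
        rw [hXs]; dsimp only; rw [if_pos hLE', hE]; ring
      rw [hX]
      have hE0 : 0 ≤ E := by positivity
      have hACE : 0 ≤ ALam K δ ρb * Ch * E := by positivity
      calc r⁻¹ * max (1 - |s - t₀| / r) 0 * |markI r δ K h (Φ.flow s z) (Φ.flow s z i).1 (pvel Φ z s i j).1 (Φ.flow s z i).2 x₀|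
          ≤ r⁻¹ * max (1 - |s - t₀| / r) 0 * (Ch * (2 * ALam K δ ρb + 2 * (E + E)) * W s i j x₀) := by
            refine mul_le_mul_of_nonneg_left (hm.trans ?_) ht.1
            refine mul_le_mul_of_nonneg_right (mul_le_mul_of_nonneg_left (by linarith) hCh0) hcc
        _ ≤ r⁻¹ * max (1 - |s - t₀| / r) 0 * W s i j x₀ * (Ch * (2 * ALam K δ ρb + 4) * (1 + E)) := by
            rw [mul_assoc (r⁻¹ * max (1 - |s - t₀| / r) 0) (W s i j x₀)]
            refine mul_le_mul_of_nonneg_left ?_ ht.1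
            rw [mul_comm (Ch * (2 * ALam K δ ρb + 2 * (E + E))) (W s i j x₀)]
            refine mul_le_mul_of_nonneg_left ?_ hcc
            nlinarith [hACE, hCh0, hE0]
    · rw [if_neg hLE, mul_zero, zero_mul, abs_zero]
      exact mul_nonneg (mul_nonneg ht.1 hcc) (hXs0 s i j)
  -- Step 2: integrate the domination
  have hGc : Continuous fun p : ℝ × T3 => G p.1 p.2 := by
    rw [hG]; exact continuous_csum_window Φ hz hWc Xs r τ
  have hGslice : ∀ t₀, Integrable (G t₀) (volume : Measure T3) := fun t₀ => by
    have h1 : Continuous fun x₀ : T3 => G t₀ x₀ := (hGc.comp (continuous_const.prodMk continuous_id) :)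
    exact integrable_of_continuous_T3 h1
  have hGint : Continuous fun t₀ => ∫ x₀, G t₀ x₀ := by
    have hGc' : Continuous (Function.uncurry G) := hGc
    have h := continuous_parametric_integral_of_continuous (μ := (volume : Measure T3)) hGc' isCompact_univ
    simp only [Measure.restrict_univ] at h
    exact h
  have hstep : ∫ t₀ in Set.Icc 0 τ, ∫ x₀,
      |csum Φ τ (fun s i j => r⁻¹ * max (1 - |s - t₀| / r) 0 *
          markI r δ K h (Φ.flow s z) (Φ.flow s z i).1 (pvel Φ z s i j).1 (Φ.flow s z i).2 x₀) z -
        csum Φ τ (fun s i j => r⁻¹ * max (1 - |s - t₀| / r) 0 * cutL L (pvel Φ z s i j).1 (pvel Φ z s i j).2 *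
          markI r δ K h (Φ.flow s z) (Φ.flow s z i).1 (pvel Φ z s i j).1 (Φ.flow s z i).2 x₀) z| ≤
      ∫ t₀ in Set.Icc 0 τ, ∫ x₀, G t₀ x₀ := by
    refine integral_mono_of_nonneg (ae_of_all _ fun t₀ => integral_nonneg fun x₀ => abs_nonneg _)
      (hGint.continuousOn.integrableOn_compact isCompact_Icc) (ae_of_all _ fun t₀ => ?_)
    exact integral_mono_of_nonneg (ae_of_all _ fun x₀ => abs_nonneg _) (hGslice t₀) (ae_of_all _ fun x₀ => hdom t₀ x₀)
  refine hstep.trans ?_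
  -- Step 3: exchange and the unit masses
  rw [hG, integral_integral_csum_window Φ hz hWc Xs 0 τ r τ, ← csum_const_mul Φ hz]
  refine csum_mono Φ hz hσ fun s _ i j => ?_
  have hW1 : ∫ x₀, W s i j x₀ = 1 := integral_integral_coneCone hr hr2 _
  rw [hW1, mul_one]
  calc (∫ t₀ in Set.Icc 0 τ, r⁻¹ * max (1 - |s - t₀| / r) 0) * Xs s i j ≤ 1 * Xs s i j :=
        mul_le_mul_of_nonneg_right (setIntegral_tent_le_one hr s _) (hXs0 s i j)
    _ = _ := by rw [one_mul]

end KentKr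

/-- **Registered sub-goal `stub_localEquilibriumFromDissipationD` (helper D of `stub_localEquilibriumFromDissipation`):
the cone–cone kernel has unit mass** — `∫_{x₀} ∫ₓ b_r(x, x₀) b_r(y, x) dx dx₀ = 1` for `0 < r < 1/2`. [folklore] -/
theorem stub_localEquilibriumFromDissipationD : ∀ {r : ℝ}, 0 < r → r < 1 / 2 → ∀ (y : T3), ∫ x₀ : T3, ∫ x : T3, cone r x x₀ * cone r y x = 1 :=
  fun hr hr2 y => integral_integral_coneCone hr hr2 y

end Summit.AtomisticToContinuum.HydrodynamicLimit.Theorems.ChaosClosesEulerLocalEquilibriumFromDissipation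

end
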